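import Summits.CriticalPhenomena.PercolationContinuityZ3.Theorems.PercNearOneGluingNoHeavyLowerTailMajorityGluingQCert3SixFour
import Summits.CriticalPhenomena.PercolationContinuityZ3.Theorems.PercNearOneGluingNoHeavyLowerTailMajorityGluingQCert3Slice
import HarnessLib

/-!
# The degree-3 certificate `sixFour3` (`61/50` for four of six relays cut): slice checks 6, 7 (lane prim-rate, constants-miner 1, gen 34; CANDIDATES §GEN-34 R329–R330)

Support file for the closed crux `NoHeavyLowerTail` (stmt-CriticalPhenomena-4575), majority-gluing line.  `decide +kernel` evaluations of `Cert3.checkSlice` (`…QCert3Slice`) on the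
landed data `QCert.sixFour3` (`…QCert3SixFour*`); one slice ≈ 10–30 s of kernel time.  With all 65 slices and the partition identity (NEXT-g35 item 0) these give `sixFour3_eval`
and, via `cut_of_eval3_count`, `μ(4 ≤ #cut T) ≤ (61/50)·δ` from a DEGREE-3 certificate.  No sorries.
-/

namespace Summit.CriticalPhenomena.PercolationContinuityZ3.Theorems

namespace HubOnly
namespace QCert

set_option maxHeartbeats 0 in
/-- Slice `6` of the degree-3 certificate `sixFour3` passes (contributions with smallest index `6`, sorted and run-scanned in the kernel). -/
theorem sixFour3_slice_6 : sixFour3.checkSlice 6 16 = true := by decide +kernel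

set_option maxHeartbeats 0 in
/-- Slice `7` of the degree-3 certificate `sixFour3` passes (contributions with smallest index `7`, sorted and run-scanned in the kernel). -/
theorem sixFour3_slice_7 : sixFour3.checkSlice 7 16 = true := by decide +kernel

end QCert
end HubOnly

end Summit.CriticalPhenomena.PercolationContinuityZ3.Theorems
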